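import Mathlib
import Summits.NavierStokesRegularity.NavierStokesRegularity.Theorems.TaoLadderRungTwoBreakBlowupRigidityOneViscousTopFlux
import HarnessLib

/-!
# The sign-free TRANSMISSION LAW of the mixed-drain pair `M(u,v)` along VISCOUS flows: for every NS-scaled viscosity
  `ν̂ ≥ 0`, along any `ν̂`-viscous flow of `M(u,v)` from a one-shell datum, `√(D_n(t)² + Σ_{n<j≤K} ‖x_j(t)‖²) ≤
  2|u/v|√(u²+v²) Λ^n ∫₀ᵗ b_n²` for every `K` — dissipation only helps; this is the form in which the law meets the
  viscous companions of a robust blow-up (census item (MP′) of K2(1) `TaoLadderRungTwoBreak.BlowupRigidityOne`,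
  stmt-NavierStokesRegularity-20206; `--supports`)

MODEL lattice ODEs only (Tao 2016 §4: the NS-scaled viscous lattice before Thm. 4.2, (4.3), Lemma 4.1 (4.5), (4.9)–(4.10));
nothing here is a statement about the Navier–Stokes equations; NO item is closed.  DEF-FREE; ROUTE-INDEPENDENT MODULE.

THE ESTIMATE.  For the `ν̂`-viscous law `ẋ = quadTerm − ν̂(1+ε₀)^{2k}x` of `M(u,v)` the drain defect `D_n = (u/v)b_n − a_n` obeys
`Ḋ_n = 2Λ^n b_n G_{n+1} − ν̂(1+ε₀)^{2n} D_n` (both modes are damped at the same rate), and the truncated tail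
`S_K − S_n = Σ_{n<j≤K}‖x_j‖²` obeys `(S_K − S_n)' = f_n − f_K − (dissipation)`, `f_n = 4Λ^n a_n b_n G_{n+1}`
(`viscousPartialEnergy_hasDerivWithinAt`); so `Ψ_K = D_n² + S_K − S_n ≥ ‖x_{n+1}‖²` has
`Ψ_K' ≤ 4|u/v|Λ^n b_n²|G_{n+1}| + |f_K| ≤ w√Ψ_K + C_f q^K` on `[0,t]` (`viscousTopFlux_le_geometric`), and the square-root
comparison with additive error (`sqrt_le_of_deriv_le_sqrt_add`) plus `K → ∞` give the law for every fixed `K`; no infinite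
sums are needed.  NUMERICAL CONTEXT (census #60, this hand): inviscid `M(u,v)` fronts blow up but are SUB-surviving
(`μ ≈ Λ^{−1.1…−1.5} < (1+ε₀)^{−1}`), and viscous companions stall — the law is the first inequality towards the
sub-surviving envelope (MP′) on those companions.

* `sqrt_defectTail_le_wakePrimitive_visc_mixedDrainPair` — the law with any primitive `J` of `b_n²`, every `K ≥ n+1`;
* `norm_shellVec_succ_le_wakeIntegral_visc_mixedDrainPair` — `‖x_{n+1}(t)‖ ≤ 2|u/v|√(u²+v²) Λ^n ∫₀ᵗ b_n²` (`ν̂ ≥ 0`).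

HONEST LABEL: an a-priori inequality for one explicit table family at every viscosity; (MP′) is NOT proved; no stub,
crux, rung or summit is proved; rung 0.
-/

noncomputable section

-- the summit and its single sub-problem share the name (CONVENTIONS §1)
set_option linter.dupNamespace false

open Set Filter Topology MeasureTheory
open scoped RealInnerProductSpace

namespace Summit.NavierStokesRegularity.NavierStokesRegularity.Theorems

namespace BlowupRigidityOne

open Literature.Analysis.FluidPDE Literature.Analysis.FluidPDE.TaoCascade

/-- **SIGN-FREE TRANSMISSION LAW ALONG VISCOUS FLOWS (primitive form, truncated tails).**  `ν̂ ≥ 0`; a `ν̂`-viscous flow of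
`M(u,v)` (`v ≠ 0`) on `[0,T)` from a one-shell datum at shell `0`, (4.5)-regular on every `[0,T']`, `T' < T`; `n ≥ 1`; `J` any
primitive of `b_n²` on `[0,T)`.  Then for every `K ≥ n+1` and `t < T`:
`√( ((u/v)b_n(t) − a_n(t))² + Σ_{n<j≤K} ‖x_j(t)‖² ) ≤ 2|u/v|√(u²+v²) Λ^n (J(t) − J(0))`.
[cite: Tao2016AveragedNS, §4 (the viscous equation before Thm. 4.2), (4.3), Lemma 4.1 (4.5), (4.9)–(4.10); cell vocabulary (census item (MP′))] -/
theorem sqrt_defectTail_le_wakePrimitive_visc_mixedDrainPair {u v ε₀ ν T : ℝ} (hv : v ≠ 0) (hε : 0 < ε₀) (hν : 0 ≤ ν)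
    {X : Fin 4 → ℤ → ℝ → ℝ} {X₀ : Fin 4 → ℝ}
    (hder : ∀ i k, ∀ t ∈ Ico 0 T, HasDerivWithinAt (X i k) (quadTerm ε₀ (fun (i₁ i₂ i₃ : Fin 4) (μ : ℤ × ℤ × ℤ) => if μ = ((0 : ℤ), (0 : ℤ), (1 : ℤ)) then
        (if (i₁ = 0 ∧ i₂ = 1) ∨ (i₁ = 1 ∧ i₂ = 0) then (if i₃ = 0 then u else if i₃ = 1 then v else 0) else 0)
      else if μ = ((1 : ℤ), (0 : ℤ), (0 : ℤ)) then
        (if i₁ = 0 ∧ i₂ = 1 ∧ i₃ = 0 then -u else if i₁ = 1 ∧ i₂ = 1 ∧ i₃ = 0 then -v else 0)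
      else if μ = ((0 : ℤ), (1 : ℤ), (0 : ℤ)) then
        (if i₁ = 1 ∧ i₂ = 0 ∧ i₃ = 0 then -u else if i₁ = 1 ∧ i₂ = 1 ∧ i₃ = 0 then -v else 0) else 0) X i k t
      - ν * (1 + ε₀) ^ ((2 : ℝ) * k) * X i k t) (Ici 0) t)
    (hinit : ∀ i k, X i k 0 = if k = 0 then X₀ i else 0)
    (hlow : ∀ i k t, k < 0 → X i k t = 0)
    (hreg : ∀ T' : ℝ, T' < T → ∃ M : ℝ, ∀ t ∈ Icc 0 T', ∀ (i : Fin 4) (k : ℤ),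
      (1 + (1 + ε₀) ^ ((10 : ℝ) * k)) * |X i k t| ≤ M)
    {n : ℕ} (hn : 1 ≤ n) {J : ℝ → ℝ} (hJ : ∀ τ ∈ Ico 0 T, HasDerivWithinAt J (X 1 n τ ^ 2) (Ici 0) τ)
    {t : ℝ} (ht : t ∈ Ico 0 T) {K : ℕ} (hK : n + 1 ≤ K) :
    Real.sqrt ((u / v * X 1 n t - X 0 n t) ^ 2 +
        (∑ j ∈ Finset.range (K + 1), ‖shellVec X (j : ℤ) t‖ ^ 2 -
          ∑ j ∈ Finset.range (n + 1), ‖shellVec X (j : ℤ) t‖ ^ 2)) ≤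
      2 * |u / v| * Real.sqrt (u ^ 2 + v ^ 2) * bigLam ε₀ ^ (n : ℤ) * (J t - J 0) := by
  have hl0 : (0 : ℝ) < 1 + ε₀ := by linarith
  have hL : 0 < bigLam ε₀ := bigLam_pos (by linarith)
  have hc := isCancellingCoeff_mixedDrainPair u v
  set Ln : ℝ := bigLam ε₀ ^ (n : ℤ) with hLn
  have hLn0 : 0 < Ln := zpow_pos hL _
  have hsub : Icc (0 : ℝ) t ⊆ Ico 0 T := fun s hs => ⟨hs.1, lt_of_le_of_lt hs.2 ht.2⟩
  -- partial energies, their balance, the geometric top-flux bound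
  set S : ℕ → ℝ → ℝ := fun K' τ => ∑ k ∈ Finset.range (K' + 1), ‖shellVec X (k : ℤ) τ‖ ^ 2 with hSdef
  have hSder := fun K' τ (hτ : τ ∈ Ico (0 : ℝ) T) => viscousPartialEnergy_hasDerivWithinAt hε hc hder hlow K' hτ
  obtain ⟨Cf, q, hCf0, hq0, hq1, hfbound⟩ := viscousTopFlux_le_geometric hε hc hreg ht
  have hd0 : ∀ (k : ℕ) (τ : ℝ), 0 ≤ 2 * (ν * (1 + ε₀) ^ ((2 : ℝ) * ((k : ℤ) : ℝ))) * ‖shellVec X (k : ℤ) τ‖ ^ 2 :=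
    fun k τ => by
      have := Real.rpow_nonneg hl0.le ((2 : ℝ) * ((k : ℤ) : ℝ))
      positivity
  -- initial values: every partial energy is the datum energy at time `0`
  have hS0 : ∀ K' : ℕ, S K' 0 = ∑ i, X₀ i ^ 2 := by
    intro K'
    simp only [hSdef]
    rw [Finset.sum_eq_single 0]
    · rw [EuclideanSpace.norm_eq, Real.sq_sqrt (Finset.sum_nonneg fun i _ => by positivity)]
      refine Finset.sum_congr rfl fun i _ => ?_
      simp [shellVec, hinit]
    · intro k _ hk
      have : shellVec X (k : ℤ) 0 = 0 := by
        ext i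
        simp [shellVec, hinit, hk]
      rw [this, norm_zero, zero_pow two_ne_zero]
    · intro h; exact absurd (Finset.mem_range.2 (Nat.succ_pos K')) h
  -- the modes of shell `n` and the drain defect along the viscous law
  set w : ℝ := ν * (1 + ε₀) ^ ((2 : ℝ) * (n : ℝ)) with hwdef
  have hw0 : 0 ≤ w := by have := Real.rpow_nonneg hl0.le ((2 : ℝ) * (n : ℝ)); positivity
  set G : ℝ → ℝ := fun τ => u * X 0 ((n : ℤ) + 1) τ + v * X 1 ((n : ℤ) + 1) τ with hG
  set F : ℝ → ℝ := fun τ => 2 * bigLam ε₀ ^ ((n : ℤ) - 1) * (X 0 ((n : ℤ) - 1) τ * X 1 ((n : ℤ) - 1) τ) with hF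
  have hgain_m : (1 + ε₀) ^ ((5 : ℝ) * ((n : ℝ) - 1) / 2) = bigLam ε₀ ^ ((n : ℤ) - 1) := by
    have h := DSSOneShift.bigLam_zpow_eq_rpow hl0 ((n : ℤ) - 1)
    push_cast at h
    exact h
  have hgain_n : (1 + ε₀) ^ ((5 : ℝ) * (n : ℝ) / 2) = Ln := by
    have h := DSSOneShift.bigLam_zpow_eq_rpow hl0 (n : ℤ)
    push_cast at h
    exact h
  have hb : ∀ τ ∈ Ico (0 : ℝ) T, HasDerivWithinAt (X 1 n) (v * F τ - w * X 1 n τ) (Ici 0) τ := by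
    intro τ hτ
    have h := hder 1 (n : ℤ) τ hτ
    rw [quadTerm_mixedDrainPair, if_neg (show (1 : Fin 4) ≠ 0 by decide), if_pos rfl] at h
    refine h.congr_deriv ?_
    push_cast
    rw [hgain_m, hF, hwdef]
    ring
  have ha : ∀ τ ∈ Ico (0 : ℝ) T,
      HasDerivWithinAt (X 0 n) (u * F τ - 2 * Ln * (X 1 n τ * G τ) - w * X 0 n τ) (Ici 0) τ := by
    intro τ hτ
    have h := hder 0 (n : ℤ) τ hτ
    rw [quadTerm_mixedDrainPair, if_pos rfl] at h
    refine h.congr_deriv ?_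
    push_cast
    rw [hgain_m, hgain_n, hF, hG, hwdef]
    ring
  set D : ℝ → ℝ := fun s => u / v * X 1 n s - X 0 n s with hDdef
  have hDder : ∀ τ ∈ Ico (0 : ℝ) T, HasDerivWithinAt D (2 * Ln * (X 1 n τ * G τ) - w * D τ) (Ici 0) τ := by
    intro τ hτ
    have h := ((hb τ hτ).const_mul (u / v)).sub (ha τ hτ)
    refine h.congr_deriv ?_
    simp only [hDdef]
    field_simp
    ring
  -- the flux out of shell `n` in terms of the modes
  have hfn : ∀ τ, 2 * bigLam ε₀ ^ (n : ℤ) * ⟪shellVec X ((n : ℤ) + 1) τ, tableA (fun (i₁ i₂ i₃ : Fin 4) (μ : ℤ × ℤ × ℤ) => if μ = ((0 : ℤ), (0 : ℤ), (1 : ℤ)) then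
        (if (i₁ = 0 ∧ i₂ = 1) ∨ (i₁ = 1 ∧ i₂ = 0) then (if i₃ = 0 then u else if i₃ = 1 then v else 0) else 0)
      else if μ = ((1 : ℤ), (0 : ℤ), (0 : ℤ)) then
        (if i₁ = 0 ∧ i₂ = 1 ∧ i₃ = 0 then -u else if i₁ = 1 ∧ i₂ = 1 ∧ i₃ = 0 then -v else 0)
      else if μ = ((0 : ℤ), (1 : ℤ), (0 : ℤ)) then
        (if i₁ = 1 ∧ i₂ = 0 ∧ i₃ = 0 then -u else if i₁ = 1 ∧ i₂ = 1 ∧ i₃ = 0 then -v else 0) else 0) (shellVec X (n : ℤ) τ)⟫ =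
      4 * Ln * (X 0 n τ * X 1 n τ) * G τ := by
    intro τ
    rw [inner_tableA_mixedDrainPair]
    simp only [hLn, hG, shellVec_apply]
    ring
  -- the truncated-tail functional `Ψ_{K'} = D² + (S_{K'} - S_n)`, `K' ≥ n + 1`
  have hmain : ∀ K' : ℕ, n + 1 ≤ K' → ∀ δ : ℝ, 0 < δ →
      Real.sqrt (D t ^ 2 + (S K' t - S n t)) ≤
        δ + 2 * |u / v| * Real.sqrt (u ^ 2 + v ^ 2) * Ln * (J t - J 0) + Cf * q ^ K' * t / (2 * δ) := by
    intro K' hK' δ hδ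
    have hmono : ∀ τ, S n τ + ‖shellVec X ((n : ℤ) + 1) τ‖ ^ 2 ≤ S K' τ := by
      intro τ
      have h1 : S (n + 1) τ = S n τ + ‖shellVec X ((n : ℤ) + 1) τ‖ ^ 2 := by
        simp only [hSdef]
        rw [Finset.sum_range_succ]
        push_cast
        ring
      have h2 : S (n + 1) τ ≤ S K' τ :=
        Finset.sum_le_sum_of_subset_of_nonneg (Finset.range_mono (Nat.succ_le_succ hK'))
          fun j _ _ => sq_nonneg ‖shellVec X (j : ℤ) τ‖
      linarith
    have hΨnn : ∀ τ ∈ Ico (0 : ℝ) T, 0 ≤ D τ ^ 2 + (S K' τ - S n τ) := fun τ _ => by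
      nlinarith [hmono τ, sq_nonneg (D τ), sq_nonneg ‖shellVec X ((n : ℤ) + 1) τ‖]
    have hΨder : ∀ τ ∈ Ico (0 : ℝ) T, HasDerivWithinAt (fun s => D s ^ 2 + (S K' s - S n s))
        (2 * D τ * (2 * Ln * (X 1 n τ * G τ) - w * D τ) +
          ((-(2 * bigLam ε₀ ^ (K' : ℤ) *
                ⟪shellVec X ((K' : ℤ) + 1) τ, tableA (fun (i₁ i₂ i₃ : Fin 4) (μ : ℤ × ℤ × ℤ) => if μ = ((0 : ℤ), (0 : ℤ), (1 : ℤ)) then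
        (if (i₁ = 0 ∧ i₂ = 1) ∨ (i₁ = 1 ∧ i₂ = 0) then (if i₃ = 0 then u else if i₃ = 1 then v else 0) else 0)
      else if μ = ((1 : ℤ), (0 : ℤ), (0 : ℤ)) then
        (if i₁ = 0 ∧ i₂ = 1 ∧ i₃ = 0 then -u else if i₁ = 1 ∧ i₂ = 1 ∧ i₃ = 0 then -v else 0)
      else if μ = ((0 : ℤ), (1 : ℤ), (0 : ℤ)) then
        (if i₁ = 1 ∧ i₂ = 0 ∧ i₃ = 0 then -u else if i₁ = 1 ∧ i₂ = 1 ∧ i₃ = 0 then -v else 0) else 0) (shellVec X (K' : ℤ) τ)⟫) -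
              ∑ k ∈ Finset.range (K' + 1),
                2 * (ν * (1 + ε₀) ^ ((2 : ℝ) * ((k : ℤ) : ℝ))) * ‖shellVec X (k : ℤ) τ‖ ^ 2) -
            (-(2 * bigLam ε₀ ^ (n : ℤ) *
                ⟪shellVec X ((n : ℤ) + 1) τ, tableA (fun (i₁ i₂ i₃ : Fin 4) (μ : ℤ × ℤ × ℤ) => if μ = ((0 : ℤ), (0 : ℤ), (1 : ℤ)) then
        (if (i₁ = 0 ∧ i₂ = 1) ∨ (i₁ = 1 ∧ i₂ = 0) then (if i₃ = 0 then u else if i₃ = 1 then v else 0) else 0)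
      else if μ = ((1 : ℤ), (0 : ℤ), (0 : ℤ)) then
        (if i₁ = 0 ∧ i₂ = 1 ∧ i₃ = 0 then -u else if i₁ = 1 ∧ i₂ = 1 ∧ i₃ = 0 then -v else 0)
      else if μ = ((0 : ℤ), (1 : ℤ), (0 : ℤ)) then
        (if i₁ = 1 ∧ i₂ = 0 ∧ i₃ = 0 then -u else if i₁ = 1 ∧ i₂ = 1 ∧ i₃ = 0 then -v else 0) else 0) (shellVec X (n : ℤ) τ)⟫) -
              ∑ k ∈ Finset.range (n + 1),
                2 * (ν * (1 + ε₀) ^ ((2 : ℝ) * ((k : ℤ) : ℝ))) * ‖shellVec X (k : ℤ) τ‖ ^ 2))) (Ici 0) τ := by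
      intro τ hτ
      have h := ((hDder τ hτ).pow 2).add ((hSder K' τ hτ).sub (hSder n τ hτ))
      refine h.congr_deriv ?_
      push_cast
      ring
    have hΨ0 : D 0 ^ 2 + (S K' 0 - S n 0) = 0 := by
      have hn0 : (n : ℤ) ≠ 0 := by exact_mod_cast (by omega : n ≠ 0)
      have ha0 : X 0 n 0 = 0 := by rw [hinit, if_neg hn0]
      have hb0 : X 1 n 0 = 0 := by rw [hinit, if_neg hn0]
      simp only [hDdef, ha0, hb0, hS0]
      ring
    have hGle : ∀ τ ∈ Ico (0 : ℝ) T, |G τ| ≤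
        Real.sqrt (u ^ 2 + v ^ 2) * Real.sqrt (D τ ^ 2 + (S K' τ - S n τ)) := by
      intro τ hτ
      have hab := sq_add_sq_le_norm_sq_shellVec X ((n : ℤ) + 1) τ
      have hG2 : G τ ^ 2 ≤ (u ^ 2 + v ^ 2) * (D τ ^ 2 + (S K' τ - S n τ)) := by
        have h1 : G τ ^ 2 ≤ (u ^ 2 + v ^ 2) * (X 0 ((n : ℤ) + 1) τ ^ 2 + X 1 ((n : ℤ) + 1) τ ^ 2) := by
          simp only [hG]
          nlinarith [sq_nonneg (u * X 1 ((n : ℤ) + 1) τ - v * X 0 ((n : ℤ) + 1) τ)]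
        have h2 : X 0 ((n : ℤ) + 1) τ ^ 2 + X 1 ((n : ℤ) + 1) τ ^ 2 ≤ D τ ^ 2 + (S K' τ - S n τ) := by
          nlinarith [hmono τ, sq_nonneg (D τ)]
        exact h1.trans (mul_le_mul_of_nonneg_left h2 (by positivity))
      calc |G τ| ≤ Real.sqrt ((u ^ 2 + v ^ 2) * (D τ ^ 2 + (S K' τ - S n τ))) := Real.abs_le_sqrt hG2
        _ = Real.sqrt (u ^ 2 + v ^ 2) * Real.sqrt (D τ ^ 2 + (S K' τ - S n τ)) :=
            Real.sqrt_mul (by positivity) _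
    set c : ℝ := 4 * |u / v| * Real.sqrt (u ^ 2 + v ^ 2) * Ln with hcdef
    have hJ' : ∀ τ ∈ Ico (0 : ℝ) T, HasDerivWithinAt (fun s => c * J s) (c * X 1 n τ ^ 2) (Ici 0) τ :=
      fun τ hτ => (hJ τ hτ).const_mul c
    have hle : ∀ τ ∈ Icc (0 : ℝ) t,
        2 * D τ * (2 * Ln * (X 1 n τ * G τ) - w * D τ) +
          ((-(2 * bigLam ε₀ ^ (K' : ℤ) *
                ⟪shellVec X ((K' : ℤ) + 1) τ, tableA (fun (i₁ i₂ i₃ : Fin 4) (μ : ℤ × ℤ × ℤ) => if μ = ((0 : ℤ), (0 : ℤ), (1 : ℤ)) then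
        (if (i₁ = 0 ∧ i₂ = 1) ∨ (i₁ = 1 ∧ i₂ = 0) then (if i₃ = 0 then u else if i₃ = 1 then v else 0) else 0)
      else if μ = ((1 : ℤ), (0 : ℤ), (0 : ℤ)) then
        (if i₁ = 0 ∧ i₂ = 1 ∧ i₃ = 0 then -u else if i₁ = 1 ∧ i₂ = 1 ∧ i₃ = 0 then -v else 0)
      else if μ = ((0 : ℤ), (1 : ℤ), (0 : ℤ)) then
        (if i₁ = 1 ∧ i₂ = 0 ∧ i₃ = 0 then -u else if i₁ = 1 ∧ i₂ = 1 ∧ i₃ = 0 then -v else 0) else 0) (shellVec X (K' : ℤ) τ)⟫) -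
              ∑ k ∈ Finset.range (K' + 1),
                2 * (ν * (1 + ε₀) ^ ((2 : ℝ) * ((k : ℤ) : ℝ))) * ‖shellVec X (k : ℤ) τ‖ ^ 2) -
            (-(2 * bigLam ε₀ ^ (n : ℤ) *
                ⟪shellVec X ((n : ℤ) + 1) τ, tableA (fun (i₁ i₂ i₃ : Fin 4) (μ : ℤ × ℤ × ℤ) => if μ = ((0 : ℤ), (0 : ℤ), (1 : ℤ)) then
        (if (i₁ = 0 ∧ i₂ = 1) ∨ (i₁ = 1 ∧ i₂ = 0) then (if i₃ = 0 then u else if i₃ = 1 then v else 0) else 0)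
      else if μ = ((1 : ℤ), (0 : ℤ), (0 : ℤ)) then
        (if i₁ = 0 ∧ i₂ = 1 ∧ i₃ = 0 then -u else if i₁ = 1 ∧ i₂ = 1 ∧ i₃ = 0 then -v else 0)
      else if μ = ((0 : ℤ), (1 : ℤ), (0 : ℤ)) then
        (if i₁ = 1 ∧ i₂ = 0 ∧ i₃ = 0 then -u else if i₁ = 1 ∧ i₂ = 1 ∧ i₃ = 0 then -v else 0) else 0) (shellVec X (n : ℤ) τ)⟫) -
              ∑ k ∈ Finset.range (n + 1),
                2 * (ν * (1 + ε₀) ^ ((2 : ℝ) * ((k : ℤ) : ℝ))) * ‖shellVec X (k : ℤ) τ‖ ^ 2)) ≤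
        c * X 1 n τ ^ 2 * Real.sqrt (D τ ^ 2 + (S K' τ - S n τ)) + Cf * q ^ K' := by
      intro τ hτ
      have hτT : τ ∈ Ico (0 : ℝ) T := hsub hτ
      -- the drain defect absorbs `a_n`: `4Λⁿ b G D + f_n = 4 (u/v) Λⁿ b² G`
      have hkey : 2 * D τ * (2 * Ln * (X 1 n τ * G τ)) + 4 * Ln * (X 0 n τ * X 1 n τ) * G τ =
          4 * (u / v) * Ln * X 1 n τ ^ 2 * G τ := by
        simp only [hDdef]
        ring
      have h1 : u / v * G τ ≤ |u / v| * |G τ| := by rw [← abs_mul]; exact le_abs_self _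
      have h2 : |u / v| * |G τ| ≤ |u / v| * (Real.sqrt (u ^ 2 + v ^ 2) * Real.sqrt (D τ ^ 2 + (S K' τ - S n τ))) :=
        mul_le_mul_of_nonneg_left (hGle τ hτT) (abs_nonneg _)
      have h3 : 0 ≤ 4 * Ln * X 1 n τ ^ 2 := by positivity
      have h4 : 4 * (u / v) * Ln * X 1 n τ ^ 2 * G τ ≤
          c * X 1 n τ ^ 2 * Real.sqrt (D τ ^ 2 + (S K' τ - S n τ)) := by
        calc 4 * (u / v) * Ln * X 1 n τ ^ 2 * G τ = (4 * Ln * X 1 n τ ^ 2) * (u / v * G τ) := by ring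
          _ ≤ (4 * Ln * X 1 n τ ^ 2) *
                (|u / v| * (Real.sqrt (u ^ 2 + v ^ 2) * Real.sqrt (D τ ^ 2 + (S K' τ - S n τ)))) :=
              mul_le_mul_of_nonneg_left (h1.trans h2) h3
          _ = c * X 1 n τ ^ 2 * Real.sqrt (D τ ^ 2 + (S K' τ - S n τ)) := by simp only [hcdef]; ring
      have h5 : -(2 * bigLam ε₀ ^ (K' : ℤ) *
                ⟪shellVec X ((K' : ℤ) + 1) τ, tableA (fun (i₁ i₂ i₃ : Fin 4) (μ : ℤ × ℤ × ℤ) => if μ = ((0 : ℤ), (0 : ℤ), (1 : ℤ)) then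
        (if (i₁ = 0 ∧ i₂ = 1) ∨ (i₁ = 1 ∧ i₂ = 0) then (if i₃ = 0 then u else if i₃ = 1 then v else 0) else 0)
      else if μ = ((1 : ℤ), (0 : ℤ), (0 : ℤ)) then
        (if i₁ = 0 ∧ i₂ = 1 ∧ i₃ = 0 then -u else if i₁ = 1 ∧ i₂ = 1 ∧ i₃ = 0 then -v else 0)
      else if μ = ((0 : ℤ), (1 : ℤ), (0 : ℤ)) then
        (if i₁ = 1 ∧ i₂ = 0 ∧ i₃ = 0 then -u else if i₁ = 1 ∧ i₂ = 1 ∧ i₃ = 0 then -v else 0) else 0) (shellVec X (K' : ℤ) τ)⟫) ≤ Cf * q ^ K' :=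
        (neg_le_abs _).trans (hfbound K' τ hτ)
      have h6 : ∑ k ∈ Finset.range (n + 1),
            2 * (ν * (1 + ε₀) ^ ((2 : ℝ) * ((k : ℤ) : ℝ))) * ‖shellVec X (k : ℤ) τ‖ ^ 2 ≤
          ∑ k ∈ Finset.range (K' + 1),
            2 * (ν * (1 + ε₀) ^ ((2 : ℝ) * ((k : ℤ) : ℝ))) * ‖shellVec X (k : ℤ) τ‖ ^ 2 :=
        Finset.sum_le_sum_of_subset_of_nonneg (Finset.range_mono (by omega)) fun k _ _ => hd0 k τ
      have h7 : 0 ≤ 2 * w * D τ ^ 2 := by positivity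
      have h8 : 2 * D τ * (2 * Ln * (X 1 n τ * G τ) - w * D τ) =
          2 * D τ * (2 * Ln * (X 1 n τ * G τ)) - 2 * w * D τ ^ 2 := by ring
      rw [h8, hfn τ]
      linarith [hkey, h4, h5, h6, h7]
    have hres : Real.sqrt ((fun s => D s ^ 2 + (S K' s - S n s)) t) ≤
        δ + ((fun s => c * J s) t - (fun s => c * J s) 0) / 2 + Cf * q ^ K' * t / (2 * δ) :=
      sqrt_le_of_deriv_le_sqrt_add (T := T) (Ψ := fun s => D s ^ 2 + (S K' s - S n s))
        (Ψ' := fun τ => 2 * D τ * (2 * Ln * (X 1 n τ * G τ) - w * D τ) +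
          ((-(2 * bigLam ε₀ ^ (K' : ℤ) *
                ⟪shellVec X ((K' : ℤ) + 1) τ, tableA (fun (i₁ i₂ i₃ : Fin 4) (μ : ℤ × ℤ × ℤ) => if μ = ((0 : ℤ), (0 : ℤ), (1 : ℤ)) then
        (if (i₁ = 0 ∧ i₂ = 1) ∨ (i₁ = 1 ∧ i₂ = 0) then (if i₃ = 0 then u else if i₃ = 1 then v else 0) else 0)
      else if μ = ((1 : ℤ), (0 : ℤ), (0 : ℤ)) then
        (if i₁ = 0 ∧ i₂ = 1 ∧ i₃ = 0 then -u else if i₁ = 1 ∧ i₂ = 1 ∧ i₃ = 0 then -v else 0)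
      else if μ = ((0 : ℤ), (1 : ℤ), (0 : ℤ)) then
        (if i₁ = 1 ∧ i₂ = 0 ∧ i₃ = 0 then -u else if i₁ = 1 ∧ i₂ = 1 ∧ i₃ = 0 then -v else 0) else 0) (shellVec X (K' : ℤ) τ)⟫) -
              ∑ k ∈ Finset.range (K' + 1),
                2 * (ν * (1 + ε₀) ^ ((2 : ℝ) * ((k : ℤ) : ℝ))) * ‖shellVec X (k : ℤ) τ‖ ^ 2) -
            (-(2 * bigLam ε₀ ^ (n : ℤ) *
                ⟪shellVec X ((n : ℤ) + 1) τ, tableA (fun (i₁ i₂ i₃ : Fin 4) (μ : ℤ × ℤ × ℤ) => if μ = ((0 : ℤ), (0 : ℤ), (1 : ℤ)) then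
        (if (i₁ = 0 ∧ i₂ = 1) ∨ (i₁ = 1 ∧ i₂ = 0) then (if i₃ = 0 then u else if i₃ = 1 then v else 0) else 0)
      else if μ = ((1 : ℤ), (0 : ℤ), (0 : ℤ)) then
        (if i₁ = 0 ∧ i₂ = 1 ∧ i₃ = 0 then -u else if i₁ = 1 ∧ i₂ = 1 ∧ i₃ = 0 then -v else 0)
      else if μ = ((0 : ℤ), (1 : ℤ), (0 : ℤ)) then
        (if i₁ = 1 ∧ i₂ = 0 ∧ i₃ = 0 then -u else if i₁ = 1 ∧ i₂ = 1 ∧ i₃ = 0 then -v else 0) else 0) (shellVec X (n : ℤ) τ)⟫) -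
              ∑ k ∈ Finset.range (n + 1),
                2 * (ν * (1 + ε₀) ^ ((2 : ℝ) * ((k : ℤ) : ℝ))) * ‖shellVec X (k : ℤ) τ‖ ^ 2)))
        (w := fun τ => c * X 1 n τ ^ 2) (J := fun s => c * J s) (η := Cf * q ^ K') ht hΨder hΨnn hΨ0 hJ'
        (by positivity) hle (fun τ _ => by positivity) hδ
    have e : ((fun s => c * J s) t - (fun s => c * J s) 0) / 2 =
        2 * |u / v| * Real.sqrt (u ^ 2 + v ^ 2) * Ln * (J t - J 0) := by
      simp only [hcdef]; ring
    rw [e] at hres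
    exact hres
  -- let `K' → ∞` and `δ → 0`
  have hKmono : ∀ K' : ℕ, K ≤ K' → S K t ≤ S K' t := fun K' hK' =>
    Finset.sum_le_sum_of_subset_of_nonneg (Finset.range_mono (Nat.succ_le_succ hK'))
      fun j _ _ => sq_nonneg ‖shellVec X (j : ℤ) t‖
  refine le_of_forall_pos_le_add fun η hη => ?_
  have hCt : 0 ≤ Cf * t := mul_nonneg hCf0 ht.1
  have hpos : 0 < Cf * t + 1 := by linarith
  obtain ⟨N, hN⟩ := exists_pow_lt_of_lt_one (show 0 < η ^ 2 / (2 * (Cf * t + 1)) by positivity) hq1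
  set K' : ℕ := max K N with hK'def
  have hK'1 : n + 1 ≤ K' := hK.trans (le_max_left _ _)
  have h1 := hmain K' hK'1 (η / 2) (by positivity)
  have hqK : q ^ K' ≤ q ^ N := pow_le_pow_of_le_one hq0 hq1.le (le_max_right _ _)
  have herr : Cf * q ^ K' * t / (2 * (η / 2)) ≤ η / 2 := by
    have h2 : Cf * q ^ K' * t ≤ (Cf * t + 1) * q ^ N := by
      have h21 : Cf * t * q ^ K' ≤ Cf * t * q ^ N := mul_le_mul_of_nonneg_left hqK hCt
      have h22 : Cf * t * q ^ N ≤ (Cf * t + 1) * q ^ N :=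
        mul_le_mul_of_nonneg_right (by linarith) (pow_nonneg hq0 N)
      calc Cf * q ^ K' * t = Cf * t * q ^ K' := by ring
        _ ≤ (Cf * t + 1) * q ^ N := h21.trans h22
    have h3 : (Cf * t + 1) * q ^ N ≤ η ^ 2 / 2 := by
      have h31 : q ^ N * (2 * (Cf * t + 1)) ≤ η ^ 2 := ((lt_div_iff₀ (by positivity)).1 hN).le
      have h32 : (Cf * t + 1) * q ^ N = q ^ N * (2 * (Cf * t + 1)) / 2 := by ring
      rw [h32]
      exact div_le_div_of_nonneg_right h31 (by norm_num)
    have h4 : Cf * q ^ K' * t / (2 * (η / 2)) = Cf * q ^ K' * t / η := by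
      congr 1; ring
    rw [h4, div_le_iff₀ hη]
    calc Cf * q ^ K' * t ≤ η ^ 2 / 2 := h2.trans h3
      _ = η / 2 * η := by ring
  have hsqrt : Real.sqrt (D t ^ 2 + (S K t - S n t)) ≤ Real.sqrt (D t ^ 2 + (S K' t - S n t)) :=
    Real.sqrt_le_sqrt (by linarith [hKmono K' (le_max_left _ _)])
  have hfinal : Real.sqrt ((u / v * X 1 n t - X 0 n t) ^ 2 + (S K t - S n t)) ≤
      2 * |u / v| * Real.sqrt (u ^ 2 + v ^ 2) * Ln * (J t - J 0) + η :=
    hsqrt.trans (by linarith)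
  simpa only [hSdef] using hfinal

/-- **The next shell's amplitude along viscous flows**: `‖x_{n+1}(t)‖ ≤ 2|u/v|√(u²+v²) Λ^n ∫₀ᵗ b_n(s)² ds` for every
`ν̂ ≥ 0`, `n ≥ 1`, `t < T` — the transmitted amplitude is controlled by the time-integrated wake energy of the shell below,
whatever the viscosity. [cite: Tao2016AveragedNS, §4 (the viscous equation before Thm. 4.2), Lemma 4.1 (4.5), (4.9)–(4.10); cell vocabulary (census item (MP′))] -/
theorem norm_shellVec_succ_le_wakeIntegral_visc_mixedDrainPair {u v ε₀ ν T : ℝ} (hv : v ≠ 0) (hε : 0 < ε₀)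
    (hν : 0 ≤ ν) {X : Fin 4 → ℤ → ℝ → ℝ} {X₀ : Fin 4 → ℝ}
    (hder : ∀ i k, ∀ t ∈ Ico 0 T, HasDerivWithinAt (X i k) (quadTerm ε₀ (fun (i₁ i₂ i₃ : Fin 4) (μ : ℤ × ℤ × ℤ) => if μ = ((0 : ℤ), (0 : ℤ), (1 : ℤ)) then
        (if (i₁ = 0 ∧ i₂ = 1) ∨ (i₁ = 1 ∧ i₂ = 0) then (if i₃ = 0 then u else if i₃ = 1 then v else 0) else 0)
      else if μ = ((1 : ℤ), (0 : ℤ), (0 : ℤ)) then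
        (if i₁ = 0 ∧ i₂ = 1 ∧ i₃ = 0 then -u else if i₁ = 1 ∧ i₂ = 1 ∧ i₃ = 0 then -v else 0)
      else if μ = ((0 : ℤ), (1 : ℤ), (0 : ℤ)) then
        (if i₁ = 1 ∧ i₂ = 0 ∧ i₃ = 0 then -u else if i₁ = 1 ∧ i₂ = 1 ∧ i₃ = 0 then -v else 0) else 0) X i k t
      - ν * (1 + ε₀) ^ ((2 : ℝ) * k) * X i k t) (Ici 0) t)
    (hinit : ∀ i k, X i k 0 = if k = 0 then X₀ i else 0)
    (hlow : ∀ i k t, k < 0 → X i k t = 0)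
    (hreg : ∀ T' : ℝ, T' < T → ∃ M : ℝ, ∀ t ∈ Icc 0 T', ∀ (i : Fin 4) (k : ℤ),
      (1 + (1 + ε₀) ^ ((10 : ℝ) * k)) * |X i k t| ≤ M)
    {n : ℕ} (hn : 1 ≤ n) {t : ℝ} (ht : t ∈ Ico 0 T) :
    ‖shellVec X ((n : ℤ) + 1) t‖ ≤
      2 * |u / v| * Real.sqrt (u ^ 2 + v ^ 2) * bigLam ε₀ ^ (n : ℤ) * ∫ s in (0 : ℝ)..t, X 1 n s ^ 2 := by
  have hcont0 : ContinuousOn (X 1 n) (Ico 0 T) := fun τ hτ =>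
    ((hder 1 n τ hτ).continuousWithinAt).mono fun s hs => mem_Ici.2 hs.1
  have hJ := hasDerivWithinAt_primitive_of_continuousOn_Ico (hcont0.pow 2)
  have h := sqrt_defectTail_le_wakePrimitive_visc_mixedDrainPair hv hε hν hder hinit hlow hreg hn hJ ht
    (K := n + 1) le_rfl
  rw [intervalIntegral.integral_same, sub_zero] at h
  refine le_trans ?_ h
  rw [← Real.sqrt_sq (norm_nonneg (shellVec X ((n : ℤ) + 1) t))]
  refine Real.sqrt_le_sqrt ?_
  rw [Finset.sum_range_succ]
  push_cast
  nlinarith [sq_nonneg (u / v * X 1 n t - X 0 n t)]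

end BlowupRigidityOne

end Summit.NavierStokesRegularity.NavierStokesRegularity.Theorems

end
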